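/-
Origin: expansion seat `planner-pub-hodgecm-carver-g2-0`, handover v3 2026-08-18 (`HOME/pub-hodgecm-carver-g2/lean/CarverG2/PerL34/AssemblyWeil.lean`, md5 c4904c1f, 70 lines);
landed by the gen-6 packager in gate run 22 as `HodgeCM/PerL34/AssemblyWeil.lean` (import ^import CarverG2\.PerL34\.→import HodgeCM.PerL34. ×1; import ^import Pv[0-9]+\.PerL34\.→import HodgeCM.PerL34. ×1).
-/
/-
Origin: HOME/pub-hodgecm-carver-g2/lean/CarverG2/PerL34/AssemblyWeil.lean — session planner-pub-hodgecm-carver-g2-0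
(unit pub-hodgecm-carver-g2, THE CARVER gen 2).  Intended final place: `HodgeCM/PerL34/AssemblyWeil.lean`.
v2 (04:46Z) SUPERSEDES v1 5f580b19: the S1 Weil package is pv03's (`CharSpansWeil.lean`, one writer per concept);
this file keeps ONLY the assembly.

KIND: KERNEL glue (L5 assembly).  NEW additive file for RUN 22; lands AFTER carver `AssemblyPrint.lean` v2 (ebe46ef9) and
pv03 `CharSpansWeil.lean` (→ `HodgeCM/PerL34/CharSpansWeil.lean`; itself after pv02-g2 `CharSpans`, pv14 `P43_weilModel`
and pv03 `BallFrame` v7.3).  WIP imports (PACKAGER: rewrite `CarverG2.PerL34.AssemblyPrint` → `HodgeCM.PerL34.AssemblyPrint`,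
`Pv03.PerL34.CharSpansWeil` → `HodgeCM.PerL34.CharSpansWeil`).

NOTHING is cited or posited here.  Seam S1 of LEMMAS.md §9 fed BY NAME: the binder `h33 : CharSpans.CharSpanStepsInput T`
of `AssemblyPrint.perL_of_printDictLeaves` is supplied by pv03's `CharSpansWeil.charSpanStepsInput_of_weil` from
`CharSpansWeil.WeilStepsInput T` = per good context, pv02-g2's data `M : CharLineSpans T V c` with a `WeilPackage M`
(pv14's Weil typing per `(i, χ)` + N10-invariant + (X1) + (X2) + `SomeNonzero`, giving pv03's `GroupInputs` through
pv14's `groupInputs_of_weilModel`), `HolFrame` (pv03 `BallFrame`: ⇒ `HolFromBall`), `Dense Δ` (PRINT), and the three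
dictionary Props `Dict_thetaClass₀/₁` (DEFINITIONAL D2), `Dict_cupWedge` (PRINT Voisin).

Binder census of `perL_of_weilDictLeaves`: `M : U.ModelAxioms`; PRINT leaves `h07`, `h09a`, `h09b`, `h12b`,
`hM38 : U.Fact_cmInflation` (Shimura 1998 §6.2 Thm 3), `hAlb : T.Fact_thetaAlbanese` ([Liu21] Prop 4.13 + Thm 4.18 via R1–R4);
instantiation records `hbr` (pv11 `SeesawBridge`), `hQ` (pv02-g2 `QautBridge`), `Pc`/`A12`/`A34` (pv06 `ArchCDatum`),
`h31 : ClusterOutputs T` (pv13), `hW : CharSpansWeil.WeilStepsInput T` (pv03/pv14/pv02-g2).  No model-level node statement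
of PerL v5 §§3–4 is a binder.
-/
import Summits.HodgeConjecture.HodgeCM.PerL34.AssemblyPrint
import Summits.HodgeConjecture.HodgeCM.PerL34.CharSpansWeil

/-! PORT of `HodgeCM/PerL34/AssemblyWeil.lean` (HodgeCMPerL run 82) — verbatim mechanical port; provenance in the PORT header line. -/

set_option autoImplicit false

noncomputable section

namespace HodgeCM
namespace PerL34
namespace AssemblyWeil

open HodgeCM.Prior.Perl34File HodgeCM.Prior.Perl34File.Perl34 HodgeCM.PerL34.ArchC

variable {U : Universe}

/-- **PerL from the print leaves, the dictionary records and the Weil typing.**  `perL_of_printDictLeaves` with its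
binder `h33 : CharSpans.CharSpanStepsInput T` replaced by pv03's `hW : CharSpansWeil.WeilStepsInput T`. -/
theorem perL_of_weilDictLeaves (M : U.ModelAxioms) (T : U.ThetaModel)
    (h07 : N07_hodgeRiemann20 U) (h09a : N09a_embCover T) (h09b : N09b_innerEmb T)
    (hM38 : U.Fact_cmInflation) (hAlb : T.Fact_thetaAlbanese) (h12b : N12b_signRecipe T)
    (hbr : ∀ {L : CMField} {ι₁ : L →+* ℂ} (V : HermSpace3 L ι₁) (c : SeesawCtx L), T.GoodCtx ι₁ c →
      Nonempty (SeesawDictionary.SeesawBridge T V c (T.t12 V c) 0 1))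
    (hQ : ∀ {L : CMField} {ι₁ : L →+* ℂ} (V : HermSpace3 L ι₁) (c : SeesawCtx L), T.GoodCtx ι₁ c →
      Nonempty (QautDictionary.QautBridge T V c (T.t34 V c) 2 3))
    (Pc : ∀ {L : CMField} {ι₁ : L →+* ℂ} (V : HermSpace3 L ι₁) (c : SeesawCtx L),
      C4a.PointedCore (T.core V c))
    (A12 : ∀ {L : CMField} {ι₁ : L →+* ℂ} (V : HermSpace3 L ι₁) (c : SeesawCtx L),
      T.GoodCtx ι₁ c → Nonempty (ArchCDatum (T.core V c) (T.t12 V c) (Pc V c)))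
    (A34 : ∀ {L : CMField} {ι₁ : L →+* ℂ} (V : HermSpace3 L ι₁) (c : SeesawCtx L),
      T.GoodCtx ι₁ c → Nonempty (ArchCDatum (T.core V c) (T.t34 V c) (Pc V c)))
    (h31 : ClusterOutputs T) (hW : CharSpansWeil.WeilStepsInput T) : U.PerL :=
  perL_of_printDictLeaves M T h07 h09a h09b hM38 hAlb h12b hbr hQ Pc A12 A34 h31
    (CharSpansWeil.charSpanStepsInput_of_weil T hW)

/-- The same with N33's two KERNEL side inputs made explicit for the record: `N33eClosed` (pv01) is a theorem, and the
wedge statement `T.Open_thetaWedge` (= carver `N33_wedge T`) follows from `h31` and `hW` alone (pv03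
`CharSpansWeil.open_thetaWedge_of_weil`). -/
theorem N33_wedge_of_weil (T : U.ThetaModel) (h31 : ClusterOutputs T) (hW : CharSpansWeil.WeilStepsInput T) :
    N33_wedge T :=
  (N33_iff T).mpr (CharSpansWeil.open_thetaWedge_of_weil T n33eClosed_holds h31 hW)

end AssemblyWeil
end PerL34
end HodgeCM

end
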